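import Summits.QuantumFields.YangMills.Theorems.BalabanUVNodesN15KingModelFreeRGGaussNorm
import HarnessLib

/-!
# BalabanUVNodes ∕ N15 — THE KING-MODEL RUNG, FREE-FIELD EDITION (PART Τ-i₁): ONE GAUSSIAN BLOCK-SPIN STEP **AT THE LEVEL OF INTEGRALS** —
# `∫dφ exp(−½[β‖ψ − Qφ‖² + ⟨φ,Tφ⟩]) = 𝒩(T + βQᵀQ)·exp(−½⟨ψ, (β − β²Q(T + βQᵀQ)⁻¹Qᵀ)ψ⟩)`, the MASS-PRESERVATION identity
# `𝒩(β − β²Q(T+βQᵀQ)⁻¹Qᵀ)·𝒩(T + βQᵀQ) = (2π∕β)^{n∕2}·𝒩(T)` (King's normalisation `N` of (2.15) ∕ `exp E₀` of (2.6) ∕ (3.89)), and hence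
# «the renormalization transformation maps the mass-one Gaussian `ρ_T` to the mass-one Gaussian `ρ_{T_eff}`» (Track A, DAG node N15 = NE2;
# FAN-OUT v1.1 §N15 s3 «KING-MODEL RUNG»; regen R453 (b))

HONEST FRAMING.  Count-neutral (cell `pub-ymgap`, seat `pub-ymgap-dag-n15-e` g20; `--supports stmt-QuantumFields-27366 --as helper` = K3⁸
`SpineGivenEndpointR13SepCoPHV`).  PURE finite-dimensional Gaussian calculus on `ι → ℝ`, `κ → ℝ` with Lebesgue measure (Mathlib) — no King object, no
Bałaban object, no record key.  This is the tool file of PART Τ-i, which proves that the effective actions `S^{(k),1}` of part Τ-e's datum `kingFreeRG`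
([King1986] Thms 3.1 ∕ 3.4 by name for the free field, parts Τ-a … Τ-h, seat g19) ARE the iterates of King's renormalization transformation (2.4)–(2.6) ∕
(2.13)–(2.15) AT THE LEVEL OF INTEGRALS (part Τ-i₂, `…FreeRGBlockSpinStep`), removing part Τ-e's declared scope line «`S m k` given in CLOSED Gaussian
form; the composition law `T_{a,L}^k = T_{a_k,L^k}` at the level of integrals NOT formalised».
WHAT IS HERE (generic; `Q : Matrix κ ι ℝ` a «block average» from fine fields `φ : ι → ℝ` to coarse fields `ψ : κ → ℝ`, `T` a symmetric coercive
«current action», `β > 0` the Gaussian constant of the step):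
* §1 the two operators of the step — the completed-square precision `bsPrec β Q T = T + β·QᵀQ` on the fine fields and the EFFECTIVE coarse operator
  `bsEff β Q T = β·1 − β²·Q(T + βQᵀQ)⁻¹Qᵀ` (King's (2.14) `Δ^{(k)} = a_k − a_k²Q_kG_kQ_k^*` is this recipe, part Τ-i₂) — TWO plumbing definitions;
* §2 ★ `integral_exp_blockSpin`: `∫dφ e^{−½[β‖ψ−Qφ‖² + ⟨φ,Tφ⟩]} = 𝒩(bsPrec)·e^{−½⟨ψ, bsEff ψ⟩}` (expand the square, part Τ-a's tilt identity
  `integral_gaussTilt_eq` at `J = βQᵀψ`, and `½⟨J,(bsPrec)⁻¹J⟩ − ½β‖ψ‖² = −½⟨ψ, bsEff ψ⟩`);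
* §3 the coarse Gaussian `∫dψ e^{−½β‖ψ − v‖²} = √(2π∕β)^{|κ|}` and the Fubini letters of the joint weight (`integrable_prod_iff`: every fibre integrable,
  the fibre masses integrable — NO joint coercivity estimate needed);
* §4 ★ `gaussNorm_bsEff_mul` — MASS PRESERVATION: `𝒩(bsEff)·𝒩(bsPrec) = √(2π∕β)^{|κ|}·𝒩(T)` (the two iterated integrals of the joint weight:
  `integral_prod` ∕ `integral_prod_symm`), with `integrable_exp_bsEff` ∕ `gaussNorm_bsEff_pos` read off the same Fubini;
* §5 ★ `blockSpin_density`: `√(β∕2π)^{|κ|}·∫dφ e^{−½β‖ψ−Qφ‖²}·ρ_T(φ) = ρ_{bsEff}(ψ)` for the mass-one densities `ρ_Δ = e^{−½⟨x,Δx⟩}∕𝒩(Δ)` — the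
  Gaussian renormalization transformation with King's constant `N = (β∕2π)^{|κ|∕2}` PRESERVES MASS ONE and maps Gaussians to Gaussians.
DEDUP SELF-REPORT (read before valuing): the CONDITIONAL Gaussian step over a sub-domain `Λ₅` with boundary couplings — [Balaban1982Higgs2] (2.28) ∕
(2.34) — is kernel-proved in the lit-balaban p15 lineage (`Balaban1983to89.B2Eq228Conditioning.integral_section`, `B2Eq234SecondRepr.secondRepr`, with
`B13GaugeDevices.gaussNorm`); §2 here is the UNCONDITIONAL full-lattice specialisation in THIS lineage's vocabulary (part Τ-a `gaussNorm`, `Coercive`),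
proved from part Τ-a's tilt identity in a dozen lines — not a first in-tree completion of the square.  What is new is §4–§5 (the mass-preservation ∕
normalisation identity as a theorem about `𝒩`, determinant-free) and the packaging for part Τ-i₂.
NOT Bałaban's objects; NOT a node discharge; nothing continuum-YM ∕ ℝ⁴ ∕ OS ∕ mass-gap ∕ Clay.  0 `sorry`; TWO definitions (`bsPrec`, `bsEff`) + ONE
reducible abbreviation (`jointWeight`, the Fubini integrand on the product); standard axioms.
READING NOTE carried from ref-K READ-340 (parts Τ-f∕g∕h): every `𝒩(·)` below is a genuine positive integral only under the stated coercivity letters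
(`0 < δ`, `Coercive T δ`, `0 < β`); outside them `gaussNorm` is the Bochner junk value `0` — all theorems carry the letters as hypotheses.
Locators: [King1986] (2.4)–(2.6) p.652 (the block-spin transformation and its Gaussian normalisation `E₀`), (2.13)–(2.15) p.653 (`G_k`, `Δ^{(k)}`, the
normalisation factor `N`), (3.89)–(3.90) pp.668–669 (`E₀` as the product of the level normalisations).
-/

noncomputable section

namespace Summit.QuantumFields.YangMills.BalabanUVNodes.N15KingModelRung.FreeField

open Real Finset Matrix MeasureTheory
open Literature.MathematicalPhysics.QuantumFieldTheory.Balaban1983to89.QGQInverse (Coercive isUnit_of_coercive)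
open Literature.LinearAlgebra.Matrix (dotProduct_self_nonneg_real)

variable {ι κ : Type*} [Fintype ι] [Fintype κ] [DecidableEq ι] [DecidableEq κ]

/-! ## §1 The two operators of one Gaussian block-spin step -/

/-- **The completed-square precision of one block-spin step**: `T + β·QᵀQ` on the fine fields (King's `η^d(−Δ^η + m²) + a_kQ_kᵀQ_k = N^{−d}A₀`
in the bare step, `Δ^{(k)} + aL⁻²Q*Q = (C^{(k)})⁻¹` in the iterated step). [cite: King1986, (2.13) p.653, (2.16) p.653] -/
def bsPrec (β : ℝ) (Q : Matrix κ ι ℝ) (T : Matrix ι ι ℝ) : Matrix ι ι ℝ :=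
  T + β • (Qᵀ * Q)

/-- **The effective coarse operator of one block-spin step**: `β·1 − β²·Q(T + βQᵀQ)⁻¹Qᵀ` — King's recipe (2.14) `Δ^{(k)} = a_k − a_k²Q_kG_kQ_k^*`.
[cite: King1986, (2.14) p.653] -/
def bsEff (β : ℝ) (Q : Matrix κ ι ℝ) (T : Matrix ι ι ℝ) : Matrix κ κ ℝ :=
  β • (1 : Matrix κ κ ℝ) - β ^ 2 • (Q * (bsPrec β Q T)⁻¹ * Qᵀ)

section Algebra

variable (β : ℝ) (Q : Matrix κ ι ℝ) (T : Matrix ι ι ℝ)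

omit [DecidableEq ι] [DecidableEq κ] in
/-- `⟨x, QᵀQ x⟩ = ‖Qx‖²`. [folklore] -/
theorem dotProduct_transposeMulSelf_mulVec (x : ι → ℝ) :
    x ⬝ᵥ ((Qᵀ * Q) *ᵥ x) = (Q *ᵥ x) ⬝ᵥ (Q *ᵥ x) := by
  rw [← Matrix.mulVec_mulVec, Matrix.dotProduct_mulVec, Matrix.vecMul_transpose]

omit [DecidableEq ι] [DecidableEq κ] in
/-- `⟨ψ, Qφ⟩ = ⟨Qᵀψ, φ⟩`. [folklore] -/
theorem dotProduct_mulVec_eq_transpose (ψ : κ → ℝ) (φ : ι → ℝ) :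
    ψ ⬝ᵥ (Q *ᵥ φ) = (Qᵀ *ᵥ ψ) ⬝ᵥ φ := by
  rw [Matrix.dotProduct_mulVec, Matrix.mulVec_transpose]

omit [Fintype ι] [DecidableEq ι] [DecidableEq κ] in
/-- The precision is symmetric when `T` is. [folklore] -/
theorem bsPrec_transpose (hT : Tᵀ = T) : (bsPrec β Q T)ᵀ = bsPrec β Q T := by
  rw [bsPrec, Matrix.transpose_add, Matrix.transpose_smul, Matrix.transpose_mul, Matrix.transpose_transpose, hT]

omit [DecidableEq ι] [DecidableEq κ] in
/-- The quadratic form of the precision: `⟨φ, (T + βQᵀQ)φ⟩ = ⟨φ,Tφ⟩ + β‖Qφ‖²`. [folklore] -/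
theorem bsPrec_form (φ : ι → ℝ) :
    φ ⬝ᵥ (bsPrec β Q T *ᵥ φ) = φ ⬝ᵥ (T *ᵥ φ) + β * ((Q *ᵥ φ) ⬝ᵥ (Q *ᵥ φ)) := by
  rw [bsPrec, Matrix.add_mulVec, dotProduct_add, Matrix.smul_mulVec, dotProduct_smul, smul_eq_mul,
    dotProduct_transposeMulSelf_mulVec]

omit [DecidableEq ι] [DecidableEq κ] in
/-- The precision is coercive with the constant of `T` (`β ≥ 0`). [folklore] -/
theorem coercive_bsPrec {β : ℝ} (hβ : 0 ≤ β) {δ : ℝ} (hT : Coercive T δ) : Coercive (bsPrec β Q T) δ := by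
  intro φ
  rw [bsPrec_form]
  have h1 := hT φ
  have h2 : 0 ≤ (Q *ᵥ φ) ⬝ᵥ (Q *ᵥ φ) := dotProduct_self_nonneg_real _
  nlinarith

omit [DecidableEq ι] [DecidableEq κ] in
/-- **Expanding the square**: `β‖ψ − Qφ‖² + ⟨φ,Tφ⟩ = ⟨φ,(T + βQᵀQ)φ⟩ − 2⟨βQᵀψ, φ⟩ + β‖ψ‖²`. [cite: King1986, (2.4) p.652, (2.14) p.653] -/
theorem quad_blockSpin_expand (ψ : κ → ℝ) (φ : ι → ℝ) :
    β * ((ψ - Q *ᵥ φ) ⬝ᵥ (ψ - Q *ᵥ φ)) + φ ⬝ᵥ (T *ᵥ φ)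
      = φ ⬝ᵥ (bsPrec β Q T *ᵥ φ) - 2 * ((β • (Qᵀ *ᵥ ψ)) ⬝ᵥ φ) + β * (ψ ⬝ᵥ ψ) := by
  rw [bsPrec_form, dotProduct_sub, sub_dotProduct, sub_dotProduct, dotProduct_mulVec_eq_transpose Q ψ φ,
    dotProduct_comm (Q *ᵥ φ) ψ, dotProduct_mulVec_eq_transpose Q ψ φ, smul_dotProduct, smul_eq_mul]
  ring

/-- The effective form: `⟨ψ, bsEff ψ⟩ = β‖ψ‖² − β²⟨Qᵀψ, (T + βQᵀQ)⁻¹Qᵀψ⟩`. [cite: King1986, (2.14) p.653] -/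
theorem bsEff_form (ψ : κ → ℝ) :
    ψ ⬝ᵥ (bsEff β Q T *ᵥ ψ)
      = β * (ψ ⬝ᵥ ψ) - β ^ 2 * ((Qᵀ *ᵥ ψ) ⬝ᵥ ((bsPrec β Q T)⁻¹ *ᵥ (Qᵀ *ᵥ ψ))) := by
  have hsand : ψ ⬝ᵥ ((Q * (bsPrec β Q T)⁻¹ * Qᵀ) *ᵥ ψ) = (Qᵀ *ᵥ ψ) ⬝ᵥ ((bsPrec β Q T)⁻¹ *ᵥ (Qᵀ *ᵥ ψ)) := by
    rw [← Matrix.mulVec_mulVec, ← Matrix.mulVec_mulVec, dotProduct_mulVec_eq_transpose]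
  rw [bsEff, Matrix.sub_mulVec, dotProduct_sub, Matrix.smul_mulVec, dotProduct_smul, Matrix.one_mulVec,
    Matrix.smul_mulVec, dotProduct_smul, hsand, smul_eq_mul, smul_eq_mul]

/-- The tilt's quadratic gain minus the free coarse term is the effective form:
`½⟨βQᵀψ, (T+βQᵀQ)⁻¹ βQᵀψ⟩ − ½β‖ψ‖² = −½⟨ψ, bsEff ψ⟩`. [cite: King1986, (2.14) p.653] -/
theorem tilt_gain_eq_bsEff (ψ : κ → ℝ) :
    (1 / 2 : ℝ) * ((β • (Qᵀ *ᵥ ψ)) ⬝ᵥ ((bsPrec β Q T)⁻¹ *ᵥ (β • (Qᵀ *ᵥ ψ)))) - (1 / 2 : ℝ) * (β * (ψ ⬝ᵥ ψ))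
      = -(1 / 2 : ℝ) * (ψ ⬝ᵥ (bsEff β Q T *ᵥ ψ)) := by
  rw [bsEff_form, Matrix.mulVec_smul, smul_dotProduct, dotProduct_smul, smul_eq_mul, smul_eq_mul]
  ring

end Algebra

/-! ## §2 ★ One block-spin step evaluates: completing the square + the tilt identity -/

section Step

variable {β : ℝ} (Q : Matrix κ ι ℝ) {T : Matrix ι ι ℝ} {δ : ℝ}

omit [DecidableEq ι] [DecidableEq κ] in
/-- Continuity of the joint exponent in the fine field. [folklore] -/
theorem continuous_blockSpin_exponent_fine (β : ℝ) (T : Matrix ι ι ℝ) (ψ : κ → ℝ) :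
    Continuous fun φ : ι → ℝ => -(1 / 2 : ℝ) * (β * ((ψ - Q *ᵥ φ) ⬝ᵥ (ψ - Q *ᵥ φ)) + φ ⬝ᵥ (T *ᵥ φ)) := by
  simp only [dotProduct, Matrix.mulVec, Pi.sub_apply]
  fun_prop

/-- ★ **ONE GAUSSIAN BLOCK-SPIN STEP, EVALUATED**: for `T` symmetric with `T ≥ δ > 0` as a form and `β ≥ 0`, and every coarse field `ψ`,
`∫_{ℝ^ι} exp(−½[β‖ψ − Qφ‖² + ⟨φ, Tφ⟩]) dφ = 𝒩(T + βQᵀQ) · exp(−½⟨ψ, (β − β²Q(T + βQᵀQ)⁻¹Qᵀ)ψ⟩)` — the fine-field integral of King's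
renormalization transformation (2.4) applied to a Gaussian `e^{−½⟨φ,Tφ⟩}`: the block-spin minimum (2.14) in the exponent, the Gaussian normalisation of the
completed square in front. [cite: King1986, (2.4)–(2.6) p.652, (2.13)–(2.15) p.653] -/
theorem integral_exp_blockSpin (hδ : 0 < δ) (hT : Coercive T δ) (hsymm : Tᵀ = T) (hβ : 0 ≤ β) (ψ : κ → ℝ) :
    ∫ φ : ι → ℝ, Real.exp (-(1 / 2 : ℝ) * (β * ((ψ - Q *ᵥ φ) ⬝ᵥ (ψ - Q *ᵥ φ)) + φ ⬝ᵥ (T *ᵥ φ)))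
      = gaussNorm (bsPrec β Q T) * Real.exp (-(1 / 2 : ℝ) * (ψ ⬝ᵥ (bsEff β Q T *ᵥ ψ))) := by
  have hB : Coercive (bsPrec β Q T) δ := coercive_bsPrec Q T hβ hT
  have hBs : (bsPrec β Q T)ᵀ = bsPrec β Q T := bsPrec_transpose β Q T hsymm
  set J : ι → ℝ := β • (Qᵀ *ᵥ ψ) with hJ
  have h1 : (fun φ : ι → ℝ => Real.exp (-(1 / 2 : ℝ) * (β * ((ψ - Q *ᵥ φ) ⬝ᵥ (ψ - Q *ᵥ φ)) + φ ⬝ᵥ (T *ᵥ φ))))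
      = fun φ => Real.exp (-(1 / 2 : ℝ) * (φ ⬝ᵥ (bsPrec β Q T *ᵥ φ)) + J ⬝ᵥ φ)
          * Real.exp (-(1 / 2 : ℝ) * (β * (ψ ⬝ᵥ ψ))) := by
    funext φ
    rw [← Real.exp_add, quad_blockSpin_expand]
    congr 1
    ring
  rw [h1, integral_mul_const, integral_gaussTilt_eq hδ hB hBs J, mul_comm (Real.exp _) (gaussNorm _), mul_assoc,
    ← Real.exp_add]
  congr 2
  rw [hJ, ← tilt_gain_eq_bsEff]
  ring

omit [DecidableEq ι] [DecidableEq κ] in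
/-- The step's fine-field integrand is integrable (every fibre of the joint weight converges). [folklore] -/
theorem integrable_exp_blockSpin (hδ : 0 < δ) (hT : Coercive T δ) (hβ : 0 ≤ β) (ψ : κ → ℝ) :
    Integrable fun φ : ι → ℝ => Real.exp (-(1 / 2 : ℝ) * (β * ((ψ - Q *ᵥ φ) ⬝ᵥ (ψ - Q *ᵥ φ)) + φ ⬝ᵥ (T *ᵥ φ))) := by
  have hB : Coercive (bsPrec β Q T) δ := coercive_bsPrec Q T hβ hT
  have h := (integrable_gaussTilt hδ hB (β • (Qᵀ *ᵥ ψ))).mul_const (Real.exp (-(1 / 2 : ℝ) * (β * (ψ ⬝ᵥ ψ))))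
  refine h.congr (Filter.Eventually.of_forall fun φ => ?_)
  beta_reduce
  rw [← Real.exp_add, quad_blockSpin_expand]
  congr 1
  ring

end Step

/-! ## §3 The coarse Gaussian and the Fubini letters of the joint weight -/

section Coarse

variable {β : ℝ}

/-- `⟨x, (β·1)x⟩ = β⟨x,x⟩`. [folklore] -/
theorem quad_scalar_dot (β : ℝ) (x : κ → ℝ) : x ⬝ᵥ ((β • (1 : Matrix κ κ ℝ)) *ᵥ x) = β * (x ⬝ᵥ x) := by
  rw [Matrix.smul_mulVec, Matrix.one_mulVec, dotProduct_smul, smul_eq_mul]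

/-- **The coarse Gaussian of the step**: `∫_{ℝ^κ} exp(−½β‖ψ − v‖²) dψ = √(2π∕β)^{|κ|}` for every centre `v` (`β > 0`; translation invariance of
Lebesgue measure and part Τ-a `gaussNorm_scalar`) — the reciprocal of King's normalisation `N` of (2.15) ∕ `exp E₀` of (2.6) for the block-spin
weight. [cite: King1986, (2.6) p.652, (2.15) p.653] -/
theorem integral_exp_coarseGauss (hβ : 0 < β) (v : κ → ℝ) :
    ∫ ψ : κ → ℝ, Real.exp (-(1 / 2 : ℝ) * (β * ((ψ - v) ⬝ᵥ (ψ - v))))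
      = Real.sqrt (2 * π / β) ^ Fintype.card κ := by
  have h := integral_add_left_eq_self (μ := (volume : Measure (κ → ℝ)))
    (fun x : κ → ℝ => Real.exp (-(1 / 2 : ℝ) * (β * (x ⬝ᵥ x)))) (-v)
  simp only [neg_add_eq_sub] at h
  rw [h, ← gaussNorm_scalar hβ, gaussNorm]
  refine integral_congr_ae (Filter.Eventually.of_forall fun x => ?_)
  beta_reduce
  rw [quad_scalar_dot]

/-- The translated coarse Gaussian is integrable. [folklore] -/
theorem integrable_exp_coarseGauss (hβ : 0 < β) (v : κ → ℝ) :
    Integrable fun ψ : κ → ℝ => Real.exp (-(1 / 2 : ℝ) * (β * ((ψ - v) ⬝ᵥ (ψ - v)))) := by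
  have h0 : Integrable fun x : κ → ℝ => Real.exp (-(1 / 2 : ℝ) * (x ⬝ᵥ ((β • (1 : Matrix κ κ ℝ)) *ᵥ x))) :=
    integrable_gauss hβ (coercive_scalar β)
  have h1 := h0.comp_add_left (-v)
  refine h1.congr (Filter.Eventually.of_forall fun x => ?_)
  beta_reduce
  rw [neg_add_eq_sub, quad_scalar_dot]

variable (β) (Q : Matrix κ ι ℝ) (T : Matrix ι ι ℝ)

/-- The JOINT WEIGHT of one step on `(fine field, coarse field)`: `W(φ, ψ) = exp(−½[β‖ψ − Qφ‖² + ⟨φ,Tφ⟩])`, as a function on the product (local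
abbreviation for the Fubini letters; the theorems are stated with the explicit exponent). [cite: King1986, (2.4) p.652] -/
abbrev jointWeight (q : (ι → ℝ) × (κ → ℝ)) : ℝ :=
  Real.exp (-(1 / 2 : ℝ) * (β * ((q.2 - Q *ᵥ q.1) ⬝ᵥ (q.2 - Q *ᵥ q.1)) + q.1 ⬝ᵥ (T *ᵥ q.1)))

omit [DecidableEq ι] [DecidableEq κ] in
/-- The joint weight is continuous. [folklore] -/
theorem continuous_jointWeight : Continuous (jointWeight β Q T) := by
  unfold jointWeight
  simp only [dotProduct, Matrix.mulVec, Pi.sub_apply]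
  fun_prop

omit [DecidableEq ι] [DecidableEq κ] in
/-- The joint weight factors: `W(φ,ψ) = e^{−½⟨φ,Tφ⟩}·e^{−½β‖ψ−Qφ‖²}`. [folklore] -/
theorem jointWeight_eq_mul (φ : ι → ℝ) (ψ : κ → ℝ) :
    jointWeight β Q T (φ, ψ)
      = Real.exp (-(1 / 2 : ℝ) * (φ ⬝ᵥ (T *ᵥ φ))) * Real.exp (-(1 / 2 : ℝ) * (β * ((ψ - Q *ᵥ φ) ⬝ᵥ (ψ - Q *ᵥ φ)))) := by
  rw [jointWeight, ← Real.exp_add]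
  congr 1
  ring

variable {β T} {δ : ℝ}

omit [DecidableEq ι] in
/-- **The fibre masses**: `∫dψ W(φ,ψ) = e^{−½⟨φ,Tφ⟩}·√(2π∕β)^{|κ|}` — the coarse integral of the block-spin weight does not depend on the fine field
(this is WHY `N·∫dψ e^{−½β‖ψ−Qφ‖²} = 1` makes the transformation mass-preserving). [cite: King1986, (2.6) p.652, (2.15) p.653] -/
theorem integral_jointWeight_coarse (hβ : 0 < β) (φ : ι → ℝ) :
    ∫ ψ : κ → ℝ, jointWeight β Q T (φ, ψ)
      = Real.exp (-(1 / 2 : ℝ) * (φ ⬝ᵥ (T *ᵥ φ))) * Real.sqrt (2 * π / β) ^ Fintype.card κ := by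
  simp_rw [jointWeight_eq_mul]
  rw [integral_const_mul, integral_exp_coarseGauss hβ]

omit [DecidableEq ι] in
/-- **The joint weight is integrable on the product** (`integrable_prod_iff`: all coarse fibres integrable, the fibre masses `e^{−½⟨φ,Tφ⟩}·√(2π∕β)^{|κ|}`
integrable in `φ` — no joint coercivity estimate). [folklore] -/
theorem integrable_jointWeight (hδ : 0 < δ) (hT : Coercive T δ) (hβ : 0 < β) :
    Integrable (jointWeight β Q T) ((volume : Measure (ι → ℝ)).prod (volume : Measure (κ → ℝ))) := by
  have hm : AEStronglyMeasurable (jointWeight β Q T) ((volume : Measure (ι → ℝ)).prod (volume : Measure (κ → ℝ))) :=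
    (continuous_jointWeight β Q T).aestronglyMeasurable
  rw [integrable_prod_iff hm]
  refine ⟨Filter.Eventually.of_forall fun φ => ?_, ?_⟩
  · have h := (integrable_exp_coarseGauss hβ (Q *ᵥ φ)).const_mul (Real.exp (-(1 / 2 : ℝ) * (φ ⬝ᵥ (T *ᵥ φ))))
    refine h.congr (Filter.Eventually.of_forall fun ψ => ?_)
    beta_reduce
    rw [jointWeight_eq_mul]
  · have h := (integrable_gauss hδ hT).mul_const (Real.sqrt (2 * π / β) ^ Fintype.card κ)
    refine h.congr (Filter.Eventually.of_forall fun φ => ?_)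
    beta_reduce
    rw [← integral_jointWeight_coarse Q hβ φ]
    refine integral_congr_ae (Filter.Eventually.of_forall fun ψ => ?_)
    beta_reduce
    rw [Real.norm_eq_abs, abs_of_pos (Real.exp_pos _)]

end Coarse

/-! ## §4 ★ MASS PRESERVATION: `𝒩(bsEff)·𝒩(bsPrec) = √(2π∕β)^{|κ|}·𝒩(T)` (the two iterated integrals of the joint weight) -/

section Mass

variable {β : ℝ} (Q : Matrix κ ι ℝ) {T : Matrix ι ι ℝ} {δ : ℝ}

/-- The fine-first iterated integral: `∫dψ∫dφ W = 𝒩(bsPrec)·𝒩(bsEff)`. [cite: King1986, (2.13)–(2.15) p.653] -/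
theorem integral_integral_jointWeight_fine (hδ : 0 < δ) (hT : Coercive T δ) (hsymm : Tᵀ = T) (hβ : 0 ≤ β) :
    ∫ ψ : κ → ℝ, ∫ φ : ι → ℝ, jointWeight β Q T (φ, ψ) = gaussNorm (bsPrec β Q T) * gaussNorm (bsEff β Q T) := by
  have h : ∀ ψ : κ → ℝ, ∫ φ : ι → ℝ, jointWeight β Q T (φ, ψ)
      = gaussNorm (bsPrec β Q T) * Real.exp (-(1 / 2 : ℝ) * (ψ ⬝ᵥ (bsEff β Q T *ᵥ ψ))) :=
    fun ψ => integral_exp_blockSpin Q hδ hT hsymm hβ ψ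
  simp_rw [h]
  rw [integral_const_mul, gaussNorm, gaussNorm]

omit [DecidableEq ι] in
/-- The coarse-first iterated integral: `∫dφ∫dψ W = √(2π∕β)^{|κ|}·𝒩(T)`. [cite: King1986, (2.6) p.652, (2.15) p.653] -/
theorem integral_integral_jointWeight_coarse (hβ : 0 < β) :
    ∫ φ : ι → ℝ, ∫ ψ : κ → ℝ, jointWeight β Q T (φ, ψ) = Real.sqrt (2 * π / β) ^ Fintype.card κ * gaussNorm T := by
  simp_rw [integral_jointWeight_coarse Q hβ]
  rw [integral_mul_const, gaussNorm, mul_comm]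

/-- ★ **MASS PRESERVATION OF THE GAUSSIAN BLOCK-SPIN STEP** (King's normalisation bookkeeping (2.6) ∕ (2.15) ∕ (3.89), determinant-free):
`𝒩(β − β²Q(T+βQᵀQ)⁻¹Qᵀ) · 𝒩(T + βQᵀQ) = √(2π∕β)^{|κ|} · 𝒩(T)` — Fubini for the joint weight, whose two iterated integrals are the two sides.
Equivalently `∫dψ [N∫dφ e^{−½β‖ψ−Qφ‖²}ρ_T(φ)] = 1` with `N = √(β∕2π)^{|κ|}`. [cite: King1986, (2.6) p.652, (2.15) p.653, (3.89) p.668] -/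
theorem gaussNorm_bsEff_mul (hδ : 0 < δ) (hT : Coercive T δ) (hsymm : Tᵀ = T) (hβ : 0 < β) :
    gaussNorm (bsEff β Q T) * gaussNorm (bsPrec β Q T) = Real.sqrt (2 * π / β) ^ Fintype.card κ * gaussNorm T := by
  have hW := integrable_jointWeight Q hδ hT hβ
  have h1 := integral_prod (jointWeight β Q T) hW
  have h2 := integral_prod_symm (jointWeight β Q T) hW
  rw [integral_integral_jointWeight_coarse Q hβ] at h1
  rw [integral_integral_jointWeight_fine Q hδ hT hsymm hβ.le] at h2
  rw [mul_comm, ← h2, h1]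

/-- The effective Gaussian `e^{−½⟨ψ, bsEff ψ⟩}` is integrable (the coarse marginal of the integrable joint weight). [folklore] -/
theorem integrable_exp_bsEff (hδ : 0 < δ) (hT : Coercive T δ) (hsymm : Tᵀ = T) (hβ : 0 < β) :
    Integrable fun ψ : κ → ℝ => Real.exp (-(1 / 2 : ℝ) * (ψ ⬝ᵥ (bsEff β Q T *ᵥ ψ))) := by
  have hW := integrable_jointWeight Q hδ hT hβ
  have hm := hW.integral_prod_right
  have hB : 0 < gaussNorm (bsPrec β Q T) := gaussNorm_pos hδ (coercive_bsPrec Q T hβ.le hT)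
  have h : ∀ ψ : κ → ℝ, ∫ φ : ι → ℝ, jointWeight β Q T (φ, ψ)
      = gaussNorm (bsPrec β Q T) * Real.exp (-(1 / 2 : ℝ) * (ψ ⬝ᵥ (bsEff β Q T *ᵥ ψ))) :=
    fun ψ => integral_exp_blockSpin Q hδ hT hsymm hβ.le ψ
  simp_rw [h] at hm
  have h2 := hm.const_mul (gaussNorm (bsPrec β Q T))⁻¹
  refine h2.congr (Filter.Eventually.of_forall fun ψ => ?_)
  beta_reduce
  rw [← mul_assoc, inv_mul_cancel₀ hB.ne', one_mul]

/-- `𝒩(bsEff) > 0`. [folklore] -/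
theorem gaussNorm_bsEff_pos (hδ : 0 < δ) (hT : Coercive T δ) (hsymm : Tᵀ = T) (hβ : 0 < β) :
    0 < gaussNorm (bsEff β Q T) := by
  unfold gaussNorm
  exact integral_exp_pos (integrable_exp_bsEff Q hδ hT hsymm hβ)

/-- The normalisation ratio of the step: `𝒩(bsPrec)∕𝒩(T) = √(2π∕β)^{|κ|}∕𝒩(bsEff)`. [cite: King1986, (2.15) p.653, (3.89) p.668] -/
theorem gaussNorm_bsPrec_div (hδ : 0 < δ) (hT : Coercive T δ) (hsymm : Tᵀ = T) (hβ : 0 < β) :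
    gaussNorm (bsPrec β Q T) / gaussNorm T = Real.sqrt (2 * π / β) ^ Fintype.card κ / gaussNorm (bsEff β Q T) := by
  have hN : 0 < gaussNorm T := gaussNorm_pos hδ hT
  have hE := gaussNorm_bsEff_pos Q hδ hT hsymm hβ
  rw [div_eq_div_iff hN.ne' hE.ne', mul_comm, gaussNorm_bsEff_mul Q hδ hT hsymm hβ]

end Mass

/-! ## §5 ★ The renormalization transformation maps the mass-one Gaussian to the mass-one Gaussian -/

section Density

variable {β : ℝ} (Q : Matrix κ ι ℝ) {T : Matrix ι ι ℝ} {δ : ℝ}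

/-- `√(β∕2π)·√(2π∕β) = 1`. [folklore] -/
theorem sqrt_div_mul_sqrt_div (hβ : 0 < β) : Real.sqrt (β / (2 * π)) * Real.sqrt (2 * π / β) = 1 := by
  have hπ : 0 < 2 * π := by positivity
  rw [← Real.sqrt_mul (div_nonneg hβ.le hπ.le), div_mul_div_comm, mul_comm β, div_self (mul_pos hπ hβ).ne',
    Real.sqrt_one]

/-- ★ **THE GAUSSIAN RENORMALIZATION TRANSFORMATION ON DENSITIES**: with King's constant `N = √(β∕2π)^{|κ|}` and the mass-one densities
`ρ_Δ(x) = e^{−½⟨x,Δx⟩}∕𝒩(Δ)`,  `N · ∫dφ e^{−½β‖ψ − Qφ‖²} ρ_T(φ) = ρ_{bsEff}(ψ)` for every coarse field `ψ` — one block-spin step (2.4) maps the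
normalised Gaussian of `T` to the normalised Gaussian of the effective operator `β − β²Q(T+βQᵀQ)⁻¹Qᵀ` EXACTLY (form (2.14) AND constant).
[cite: King1986, (2.4)–(2.6) p.652, (2.13)–(2.15) p.653] -/
theorem blockSpin_density (hδ : 0 < δ) (hT : Coercive T δ) (hsymm : Tᵀ = T) (hβ : 0 < β) (ψ : κ → ℝ) :
    Real.sqrt (β / (2 * π)) ^ Fintype.card κ
        * ∫ φ : ι → ℝ, Real.exp (-(1 / 2 : ℝ) * (β * ((ψ - Q *ᵥ φ) ⬝ᵥ (ψ - Q *ᵥ φ))))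
            * (Real.exp (-(1 / 2 : ℝ) * (φ ⬝ᵥ (T *ᵥ φ))) / gaussNorm T)
      = Real.exp (-(1 / 2 : ℝ) * (ψ ⬝ᵥ (bsEff β Q T *ᵥ ψ))) / gaussNorm (bsEff β Q T) := by
  have hN : 0 < gaussNorm T := gaussNorm_pos hδ hT
  have hE := gaussNorm_bsEff_pos Q hδ hT hsymm hβ
  have h1 : (fun φ : ι → ℝ => Real.exp (-(1 / 2 : ℝ) * (β * ((ψ - Q *ᵥ φ) ⬝ᵥ (ψ - Q *ᵥ φ))))
        * (Real.exp (-(1 / 2 : ℝ) * (φ ⬝ᵥ (T *ᵥ φ))) / gaussNorm T))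
      = fun φ => Real.exp (-(1 / 2 : ℝ) * (β * ((ψ - Q *ᵥ φ) ⬝ᵥ (ψ - Q *ᵥ φ)) + φ ⬝ᵥ (T *ᵥ φ))) * (gaussNorm T)⁻¹ := by
    funext φ
    rw [mul_add, Real.exp_add]
    ring
  rw [h1, integral_mul_const, integral_exp_blockSpin Q hδ hT hsymm hβ.le ψ]
  have hratio := gaussNorm_bsPrec_div Q hδ hT hsymm hβ
  rw [div_eq_iff hN.ne'] at hratio
  -- `𝒩(bsPrec) = √(2π/β)^n / 𝒩(bsEff) · 𝒩(T)`
  rw [hratio]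
  have hkey : Real.sqrt (β / (2 * π)) ^ Fintype.card κ * Real.sqrt (2 * π / β) ^ Fintype.card κ = 1 := by
    rw [← mul_pow, sqrt_div_mul_sqrt_div hβ, one_pow]
  set E := Real.exp (-(1 / 2 : ℝ) * (ψ ⬝ᵥ (bsEff β Q T *ᵥ ψ))) with hEdef
  calc Real.sqrt (β / (2 * π)) ^ Fintype.card κ
        * (Real.sqrt (2 * π / β) ^ Fintype.card κ / gaussNorm (bsEff β Q T) * gaussNorm T * E * (gaussNorm T)⁻¹)
      = (Real.sqrt (β / (2 * π)) ^ Fintype.card κ * Real.sqrt (2 * π / β) ^ Fintype.card κ) * E / gaussNorm (bsEff β Q T)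
          * (gaussNorm T * (gaussNorm T)⁻¹) := by ring
    _ = E / gaussNorm (bsEff β Q T) := by rw [hkey, mul_inv_cancel₀ hN.ne', one_mul, mul_one]

end Density

end Summit.QuantumFields.YangMills.BalabanUVNodes.N15KingModelRung.FreeField

end
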